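import Literature.MathematicalPhysics.QuantumFieldTheory.Balaban1983to89.B9Eq365QGGQLowerVariationalWindow
import Literature.MathematicalPhysics.QuantumFieldTheory.Balaban1983to89.B9Eq319BlockPedestalLift
import Literature.MathematicalPhysics.QuantumFieldTheory.Balaban1983to89.B9Eq325ProjFormulaTower
import Literature.MathematicalPhysics.QuantumFieldTheory.Balaban1983to89.B9Thm311SitePrimeFormCoerciveTowerCanonical

/-!
# `Balaban1983to89.B9Eq365QGGQLowerVariationalWindowTowerSharp` — T. Bałaban, *Propagators for lattice gauge theories in a background field*,
# Commun. Math. Phys. **99** (1985) 389–434 [Balaban1985BackgroundPropagators] Thm 3.11 p. 416 with (3.19) p. 393, (3.24)–(3.25) p. 394, (3.35)–(3.37)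
# p. 396, and [Balaban1984PropagatorsI] (1.18) p. 20, [Balaban1984PropagatorsII] (2.74)–(2.77) p. 236: **THE `k`-LEVEL THIRD OPERATOR
# `Q̃′_kG′_k(U)²Q̃′_k(U)†` BOUNDED BELOW IN THE WINDOW BY THE PEDESTAL TEST VECTOR WITH EXACT BLOCK SUMS — CLOSED FORM** (its diagonal reading, in
# the sequel, is a LEVEL-FREE floor `κ♯₀(d, a′) = 1∕(36(24d(6∕5)^{d−1} + 1 + 9a′∕4)²)`, `9.7·10⁻⁷` at `d = 4`, `a′ = 1`, in place of the tent's `5.8·10⁻²⁰`) —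
# ne9-leaf-01's flat SHARP road (`B9Eq365QGGQLowerVariationalSharp`, `c = L∕2`, `κ♯ ≥ (12d(6∕5)^{d−1} + a′)⁻² = 1.4·10⁻⁴` flat) carried to a small
# background AND to print's composite averaging (t4-ne9-idea-1 g116 §E: «a covariant version of the SHARP (pedestal) bound is not in the tree»)

statement-level skeleton of published theorems with citation tags; proofs where landed; nothing here is a claim about the Yang–Mills mass gap

CITATION HEADER (lean-in-tree rule).  Audit cell `pub-balaban`, sub-cell `t4`, BINDER row NE9; filed by NE9 crux-team LEAF PROVER 03
(`b2b-balaban-t4-ne9-formalise-leaf-03`, gen 73), sequel of this seat's `B9Eq365QGGQLowerVariationalWindowTower` (the tent version).  Composed BY NAME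
from ne9-leaf-01's abstract variational lemmas (`B9Eq365QGGQLowerVariational` §1) and pedestal kit (`B9Eq319BlockPedestalLift`: `sum_blockOf_pedestal`,
`pedestal_step_le`, `sum_blockOf_pedestal_weights`, `norm_sq_covDerivL2K_lift_le_split`) AT BLOCK SIZE `L^{n+1}`, the owner's tower objects
(`B9Eq324DeltaPrimeATower`, `B9Eq316TowerFlatIsOneStep.siteL2Cast`), ne9-leaf-02's tower averaging letters (`B9Eq319QprimeTowerLipschitzL2`).
Sources READ in the held text (`paper:balaban1985-cmp99-background-propagators`, journal page = PDF page + 388): pp. 393–396, 416; [B5′] p. 20;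
[B6] p. 236 through the verbatim quotations of the tree's `B9Eq365QGGQLowerVariational(Sharp)`.

THE PRINT (verbatim).  [B9] p. 416 Thm 3.11: *«the operators Δ′_a, G′, (Q′G′²Q′*)⁻¹, Δ_a, G are positive definite … uniformly bounded»*; p. 393
(3.19): *«Q′_j(U) = Q′(Ū^{j−1}) … Q′(Ū)Q′(U)»*; [B5′] (1.18) p. 20: *«… with L replaced by L^k»*; [B6] p. 236: *«γ₀ a positive, absolute constant»*
(2.74)–(2.77).  NOTHING of print's constants or random-walk expansion is asserted; the floor is the cell's variational one.

WHAT IS PROVED (sorry-free; proof lane — 0 `def`; axioms standard; [folklore] Hilbert-space algebra + real arithmetic on landed letters).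
* §0 `abs_pedestal_le` (`|Π(c + k(N−1−k))| ≤ (c + N²∕4)^d`, `0 ≤ c`).
* §1 **`qggq_coercive_window_tower_sharp`** — for `0 < a′`, a background `U` on `T_{L^{n+1}m}` with `U(b) ∈ U1`, `‖U(b) − 1‖ ≤ ε`, level averages
  `‖Ū^j(b) − 1‖ ≤ ε_j` in `U1`, `hRS`, the displayed positivity `hpos′` of `Δ′_{a′,k}(U)` and the WINDOW `ρ_k·(N∕2 + N²∕4)^d ≤ θβ♯` (`N = L^{n+1}`,
  loss parameters `θ ≤ 1`, `t > 0`; NO `3 ≤ N`): `κ♯_{U,k}·‖ψ‖² ≤ re⟪ψ, Q̃′_k(U)G′_k(U)²Q̃′_k(U)†ψ⟫` — `B9Eq325ProjFormulaTower.QGGQk_pos`'s operator VERBATIM — closed form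
  `κ♯_{U,k} = (((1−θ)β♯)²∕M♯)²·(c₀N^d∕c₁)∕(1+ρ_k)²`, `M♯ = (1+t)E♯ + (1+t⁻¹)|η⁻¹|²(2M_φM_φ′ε)²d((N∕2+N²∕4)^d)²(c₀N^d∕c₁) + a′(β♯ + ρ_k(N∕2+N²∕4)^d)²`
  (`θ = 1∕2`, `t = 1` is the tent file's shape; `θ, t → 0` recovers leaf-01's flat constant in the limit of a vanishing window),
  `E♯ = |η⁻¹|²·d·(N(N²+2)∕3)·(N(2N⁴+5N²+8)∕60)^{d−1}·(c₀∕c₁)` (EXACT sums).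
SEQUELS (same seat): the pure-real floor `B9Eq365QGGQLowerVariationalSharpFloor` (Mathlib only: the energy ratio `≤ 12d(6∕5)^{d−1}β♯²`, the sup
ratio `(21∕10)^d`, `kappa_sharp_floor`) and the diagonal reading `B9Eq365QGGQLowerVariationalWindowTowerSharpDiagonal` (on `ηL^{n+1} = 1`, `c₀(L^{n+1})^d =
c₁`, edge `αη`, profile `ε_j ≤ αr^j`: `κ♯₀·‖ψ‖² ≤ re⟪ψ, Q̃′_kG′_k(U)²Q̃′_k(U)†ψ⟫`, `κ♯₀ = 1∕(36(24d(6∕5)^{d−1} + 1 + 9a′∕4)²)` — `9.7·10⁻⁷` at `d = 4`,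
`a′ = 1`, the same at every height, block ratio, rate, period and weights).
HONEST SCOPE.  The structural losses of the window road (`β∕2`, `2E + 2E′`, `(9∕4)β²`, `(3∕2)²`) are kept crude — a factor `≈ 150` below the flat `κ♯`;
`hRS`, the profile, `U, Ū^j ∈ U1` DISPLAYED (print's running axioms (3.35)–(3.37)); `L²` floor only — NOT the kernel decay of `(Q̃′_kG′_k²Q̃′_k†)⁻¹`,
NOT NE9, NOT the route (cell pub-balaban: NE9 NOT PRINTED ∕ NOT PROVED; «NE9 ⇐ the named binders»; row WALLED ON A MODEL (O-NE9-1; #5 UNRULED); spine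
PROVED 0∕9; rung (B)+1 on a finite T⁴ — NOT infinite volume, NOT mass gap, NOT BetaPertH, NOT Clay; HONEST DEPENDENCY: continuum YM on T⁴ ⇐ BetaPertH ∧
nine spine estimates (0/9 proved); BetaPertH ⇐ (D1) ∧ (D4) ∧ CAP+tail; G-an2-4 gates asym, D1 and NE2/3/4).  NEW file importing
`B9Eq365QGGQLowerVariationalWindow`, `B9Eq319BlockPedestalLift`, `B9Eq325ProjFormulaTower`, `B9Thm311SitePrimeFormCoerciveTowerCanonical` (all built);
nothing modified.  Net new unproved facts: 0.
-/

noncomputable section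

open scoped InnerProductSpace ComplexConjugate BigOperators

namespace Literature.MathematicalPhysics.QuantumFieldTheory.Balaban1983to89.B9Eq365QGGQLowerVariationalWindowTowerSharp

open B4Sect5Torus (TSite)
open B9SectCLatticeCarrier (Bond)
open B7Prop1Explicit (U1)
open B9Eq311L2Pairing (WL2)
open B9Eq319QprimeTorus (fineP offset offset_lt blockCoord)
open B11Eq103H1Complex (SiteL2K greenK covDerivL2K)
open B9Eq310HessianOperator (adTransportW)
open B5Eq172HodgePositivity (adTransportW_one)
open B9Eq315QTower (towerP UlevOf)
open B9Eq326OperatorAssembly (QprimeW)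
open B9Eq326OperatorTower (QprimeTowerW)
open B9Eq324DeltaPrimeATower (laplacePrimeAk laplacePrimeAk_isSymmetric re_inner_laplacePrimeAk GpOfUk Qtildek_one_eq_oneStep)
open B9Eq316TowerFlatIsOneStep (towerP_eq_fineP_pow siteL2Cast norm_siteL2Cast)
open B9Eq384RemainderLetters (norm_adTransportW_sub_le)
open B9Eq373DerivativeRemainderL2 (norm_covDerivL2K_sub_le)
open B9Eq319QprimeTowerLipschitzL2 (norm_QtildeTower_sub_flat_le norm_QtildeTower_one_le)
open B9Eq319BlockTentLift (profile_nonneg profile_le QprimeWL2_one_lift)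
open B9Eq319BlockPedestalLift (sum_pedestal_eq sum_pedestal_sq_eq sum_blockOf_pedestal pedestal_step_le sum_blockOf_pedestal_weights
  norm_sq_covDerivL2K_lift_le_split)
open B9Eq365QGGQLowerVariational (sq_div_mul_le_re_inner_green sq_mul_norm_sq_le_re_inner_qggq)
open B9Eq365QGGQLowerVariationalWindow (norm_sq_lift_le)
open B9Thm311SitePrimeFormCoerciveTowerCanonical (rhoTower_nonneg)

/-! ## §0 The pedestal's sup bound and the pure-real floor lemmas -/

section Arith

variable {d : ℕ}

/-- **THE PEDESTAL TENT IS BOUNDED BY `(c + N²∕4)^d`** (`0 ≤ c`; each factor `c + k(N−1−k) ∈ [0, c + N²∕4]`). [folklore]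
[cite: Balaban1984PropagatorsII, (2.74)–(2.77) p.236] -/
theorem abs_pedestal_le (N : ℕ) [NeZero N] (m : Fin d → ℕ) {c : ℝ} (hc : 0 ≤ c) (x : TSite d (fineP N m)) :
    |∏ ν, (c + ((offset N m x ν : ℕ) : ℝ) * ((N : ℝ) - 1 - (offset N m x ν : ℕ)))| ≤ (c + (N : ℝ) ^ 2 / 4) ^ d := by
  have h0 : ∀ ν, 0 ≤ c + ((offset N m x ν : ℕ) : ℝ) * ((N : ℝ) - 1 - (offset N m x ν : ℕ)) := fun ν =>
    add_nonneg hc (profile_nonneg (offset_lt N m x ν))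
  rw [abs_of_nonneg (Finset.prod_nonneg fun ν _ => h0 ν)]
  have h := Finset.prod_le_prod (s := Finset.univ) (g := fun _ => c + (N : ℝ) ^ 2 / 4) (fun ν _ => h0 ν)
    (fun ν _ => by have := profile_le N (offset N m x ν); linarith)
  rwa [Finset.prod_const, Finset.card_univ, Fintype.card_fin] at h

end Arith

/-! ## §1 The `k`-level third operator in the window by the pedestal test vector: closed form -/

section Window

variable {d : ℕ} (L : ℕ) [NeZero L] (m : Fin d → ℕ) [∀ i, NeZero (m i)] (n : ℕ)
  {𝔸 : Type*} [NormedRing 𝔸] [NormedAlgebra ℂ 𝔸] [CompleteSpace 𝔸] [NormOneClass 𝔸]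
  {W : Type*} [NormedAddCommGroup W] [InnerProductSpace ℂ W] [FiniteDimensional ℂ W] (φ : W ≃ₗ[ℂ] 𝔸)
  (c₀ : ℝ) [Fact (0 < c₀)] (η : ℝ) (c₁ : ℝ) [Fact (0 < c₁)]

omit [NeZero L] in
/-- `(a + b)² ≤ (1+t)a² + (1+t⁻¹)b²` for `t > 0` (private copy of `…SharpFloor.add_sq_le_weighted`). [folklore] -/
private theorem add_sq_le_weighted' {t : ℝ} (ht : 0 < t) (a b : ℝ) : (a + b) ^ 2 ≤ (1 + t) * a ^ 2 + (1 + t⁻¹) * b ^ 2 := by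
  have h : 2 * a * b ≤ t * a ^ 2 + t⁻¹ * b ^ 2 := by
    have h1 : 0 ≤ (t * a - b) ^ 2 := sq_nonneg _
    have h2 : t⁻¹ * (t * a - b) ^ 2 = t * a ^ 2 - 2 * a * b + t⁻¹ * b ^ 2 := by field_simp; ring
    nlinarith [mul_nonneg (inv_nonneg.2 ht.le) h1]
  nlinarith

omit [NeZero L] [∀ i, NeZero (m i)] [CompleteSpace 𝔸] [NormOneClass 𝔸] [FiniteDimensional ℂ W] [Fact (0 < c₀)] in
/-- the inverse site cast is the site cast along the reversed identity (private copy of the tent file's §0). [folklore] -/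
private theorem siteL2Cast_symm_apply' {P P' : Fin d → ℕ} (h : P = P') (l : SiteL2K ℂ d P' c₀ W) :
    (siteL2Cast ℂ h).symm l = siteL2Cast ℂ h.symm l := by
  subst h; rfl

omit [NeZero L] [∀ i, NeZero (m i)] [CompleteSpace 𝔸] [NormOneClass 𝔸] [FiniteDimensional ℂ W] in
/-- the flat derivative does not see the typing of the periods (private copy of the tent file's §0). [folklore] -/
private theorem norm_covDerivL2K_one_siteL2Cast' {P P' : Fin d → ℕ} (h : P = P') (c : ℂ) (l : SiteL2K ℂ d P c₀ W) :
    ‖covDerivL2K ℂ c₀ c (adTransportW φ (fun _ : Bond d P' => (1 : 𝔸ˣ))) (siteL2Cast ℂ h l)‖ =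
      ‖covDerivL2K ℂ c₀ c (adTransportW φ (fun _ : Bond d P => (1 : 𝔸ˣ))) l‖ := by
  subst h; rfl

set_option maxHeartbeats 400000 in
/-- **THE `k`-LEVEL THIRD OPERATOR IN THE WINDOW BY THE PEDESTAL TEST VECTOR (`c = N∕2`, `N = L^{n+1}`), CLOSED FORM**: for `0 < a′`, a
background `U` on `T_{L^{n+1}m}` with `U(b) ∈ U1`, `‖U(b) − 1‖ ≤ ε`, level averages `‖Ū^j(b) − 1‖ ≤ ε_j` in `U1`, mutually adjoint transporters,
the displayed positivity `hpos′` of `Δ′_{a′,k}(U)`, loss parameters `θ ≤ 1`, `t > 0`, and the WINDOW `ρ_k·B♯ ≤ θβ♯` (`β♯ = ((N²+2)∕6)^d`,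
`B♯ = (N∕2 + N²∕4)^d`, `ρ_k = Π_{j≤n}(1 + 2M_φM_φ′ε_j)^{d(L−1)} − 1`): `κ♯_{U,k}·‖ψ‖² ≤ re⟪ψ, Q̃′_k(U)G′_k(U)²Q̃′_k(U)†ψ⟫`,
`κ♯_{U,k} = (((1−θ)β♯)²∕M♯)²·(c₀N^d∕c₁)∕(1+ρ_k)²`, `M♯ = (1+t)E♯ + (1+t⁻¹)|η⁻¹|²(2M_φM_φ′ε)²·d·B♯²·(c₀N^d∕c₁) + a′(β♯ + ρ_kB♯)²`
(the losses of the window road as PARAMETERS: `(a+b)² ≤ (1+t)a² + (1+t⁻¹)b²`, the averaging defect eating `θβ♯`),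
`E♯ = |η⁻¹|²·d·(N(N²+2)∕3)·(N(2N⁴+5N²+8)∕60)^{d−1}·(c₀∕c₁)` — the tent version's proof with leaf-01's pedestal kit (EXACT block sums for the mass and
the flat energy); NO `3 ≤ N`, NO operator norm, NO volume.
[cite: Balaban1985BackgroundPropagators, Thm 3.11 p.416, (3.19) p.393, (3.24)–(3.25) p.394; Balaban1984PropagatorsI, (1.18) p.20; Balaban1984PropagatorsII, (2.74)–(2.77) p.236] -/
theorem qggq_coercive_window_tower_sharp {a' : ℝ} (ha' : 0 < a') {Mφ Mφ' : ℝ} (hMφ : 0 ≤ Mφ) (hMφ' : 0 ≤ Mφ')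
    (hφ : ∀ w, ‖φ w‖ ≤ Mφ * ‖w‖) (hφ' : ∀ X, ‖φ.symm X‖ ≤ Mφ' * ‖X‖)
    (U : Bond d (towerP L m (n + 1)) → 𝔸ˣ) (hU : ∀ b, U b ∈ U1 𝔸) {ε : ℝ} (hε : 0 ≤ ε) (hUε : ∀ b, ‖(U b : 𝔸) - 1‖ ≤ ε)
    (εU : ℕ → ℝ) (hεU : ∀ j, 0 ≤ εU j)
    (hLε : ∀ (j : ℕ) (b : Bond d (towerP L m (j + 1))), ‖(UlevOf L m (n + 1) U j b : 𝔸) - 1‖ ≤ εU j)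
    (hLb : ∀ (j : ℕ) (b : Bond d (towerP L m (j + 1))), UlevOf L m (n + 1) U j b ∈ U1 𝔸)
    (hRS : ∀ (b : Bond d (towerP L m (n + 1))) (v u : W), ⟪adTransportW φ U b v, u⟫_ℂ = ⟪v, adTransportW φ (fun b => (U b)⁻¹) b u⟫_ℂ)
    (hpos' : ∀ x : SiteL2K ℂ d (towerP L m (n + 1)) c₀ W, x ≠ 0 → 0 < RCLike.re ⟪x, laplacePrimeAk L m n φ η U a' (c₁ := c₁) x⟫_ℂ)
    {θ t : ℝ} (hθ1 : θ ≤ 1) (ht : 0 < t)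
    (hwin : ((∏ j ∈ Finset.range (n + 1), (1 + 2 * Mφ * Mφ' * εU j) ^ (d * (L - 1))) - 1) *
        ((L : ℝ) ^ (n + 1) / 2 + ((L : ℝ) ^ (n + 1)) ^ 2 / 4) ^ d ≤ θ * ((((L : ℝ) ^ (n + 1)) ^ 2 + 2) / 6) ^ d)
    (ψ : SiteL2K ℂ d m c₁ W) :
    ((((1 - θ) * ((((L : ℝ) ^ (n + 1)) ^ 2 + 2) / 6) ^ d) ^ 2 /
          ((1 + t) * (‖((η : ℂ))⁻¹‖ ^ 2 * ((d : ℝ) * ((L : ℝ) ^ (n + 1) * (((L : ℝ) ^ (n + 1)) ^ 2 + 2) / 3) *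
              ((L : ℝ) ^ (n + 1) * (2 * ((L : ℝ) ^ (n + 1)) ^ 4 + 5 * ((L : ℝ) ^ (n + 1)) ^ 2 + 8) / 60) ^ (d - 1)) * (c₀ / c₁)) +
            (1 + t⁻¹) * (‖((η : ℂ))⁻¹‖ ^ 2 * (2 * Mφ * Mφ' * ε) ^ 2 * (d : ℝ) * (((L : ℝ) ^ (n + 1) / 2 + ((L : ℝ) ^ (n + 1)) ^ 2 / 4) ^ d) ^ 2 *
              (c₀ * ((L : ℝ) ^ (n + 1)) ^ d / c₁)) +
            a' * (((((L : ℝ) ^ (n + 1)) ^ 2 + 2) / 6) ^ d +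
              ((∏ j ∈ Finset.range (n + 1), (1 + 2 * Mφ * Mφ' * εU j) ^ (d * (L - 1))) - 1) *
                ((L : ℝ) ^ (n + 1) / 2 + ((L : ℝ) ^ (n + 1)) ^ 2 / 4) ^ d) ^ 2)) ^ 2 *
        (c₀ * ((L : ℝ) ^ (n + 1)) ^ d / c₁) /
        (1 + ((∏ j ∈ Finset.range (n + 1), (1 + 2 * Mφ * Mφ' * εU j) ^ (d * (L - 1))) - 1)) ^ 2) * ‖ψ‖ ^ 2 ≤
      RCLike.re ⟪ψ, (((WL2.linearEquiv ℂ ℂ (fun _ : TSite d m => c₁)).symm.toLinearMap ∘ₗ QprimeTowerW L m n φ U (c₀ := c₀)) ∘ₗ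
        GpOfUk L m n φ η U a' (c₁ := c₁) hpos' ∘ₗ GpOfUk L m n φ η U a' (c₁ := c₁) hpos' ∘ₗ
        LinearMap.adjoint ((WL2.linearEquiv ℂ ℂ (fun _ : TSite d m => c₁)).symm.toLinearMap ∘ₗ QprimeTowerW L m n φ U (c₀ := c₀))) ψ⟫_ℂ := by
  have hc₀ : 0 < c₀ := Fact.out
  have hc₁ : 0 < c₁ := Fact.out
  have h : towerP L m (n + 1) = fineP (L ^ (n + 1)) m := towerP_eq_fineP_pow L m (n + 1)
  have hNr : ((L ^ (n + 1) : ℕ) : ℝ) = (L : ℝ) ^ (n + 1) := Nat.cast_pow L (n + 1)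
  have hN0 : (0 : ℝ) < (L : ℝ) ^ (n + 1) := pow_pos (by exact_mod_cast Nat.pos_of_ne_zero (NeZero.ne L)) _
  have hN0' : (L : ℝ) ^ (n + 1) ≠ 0 := hN0.ne'
  -- letters
  set Q : SiteL2K ℂ d (towerP L m (n + 1)) c₀ W →ₗ[ℂ] SiteL2K ℂ d m c₁ W :=
    (WL2.linearEquiv ℂ ℂ (fun _ : TSite d m => c₁)).symm.toLinearMap ∘ₗ QprimeTowerW L m n φ U (c₀ := c₀) with hQ
  set Q₁ : SiteL2K ℂ d (towerP L m (n + 1)) c₀ W →ₗ[ℂ] SiteL2K ℂ d m c₁ W :=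
    (WL2.linearEquiv ℂ ℂ (fun _ : TSite d m => c₁)).symm.toLinearMap ∘ₗ
      QprimeTowerW L m n φ (fun _ : Bond d (towerP L m (n + 1)) => (1 : 𝔸ˣ)) (c₀ := c₀) with hQ₁
  set T := laplacePrimeAk L m n φ η U a' (c₀ := c₀) (c₁ := c₁) with hT
  have hTs : T.IsSymmetric := laplacePrimeAk_isSymmetric L m n φ η U a' hRS
  set cN : ℝ := ((L ^ (n + 1) : ℕ) : ℝ) / 2 with hcN
  set β : ℝ := ((((L : ℝ) ^ (n + 1)) ^ 2 + 2) / 6) ^ d with hβ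
  set Bs : ℝ := ((L : ℝ) ^ (n + 1) / 2 + ((L : ℝ) ^ (n + 1)) ^ 2 / 4) ^ d with hBs
  set Φ : ℝ := (d : ℝ) * ((L : ℝ) ^ (n + 1) * (((L : ℝ) ^ (n + 1)) ^ 2 + 2) / 3) *
    ((L : ℝ) ^ (n + 1) * (2 * ((L : ℝ) ^ (n + 1)) ^ 4 + 5 * ((L : ℝ) ^ (n + 1)) ^ 2 + 8) / 60) ^ (d - 1) with hΦ
  set ρw : ℝ := c₀ * ((L : ℝ) ^ (n + 1)) ^ d / c₁ with hρw
  set E : ℝ := ‖((η : ℂ))⁻¹‖ ^ 2 * Φ * (c₀ / c₁) with hE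
  set εR : ℝ := 2 * Mφ * Mφ' * ε with hεR
  set ρ' : ℝ := (∏ j ∈ Finset.range (n + 1), (1 + 2 * Mφ * Mφ' * εU j) ^ (d * (L - 1))) - 1 with hρ'
  set E' : ℝ := ‖((η : ℂ))⁻¹‖ ^ 2 * εR ^ 2 * (d : ℝ) * Bs ^ 2 * ρw with hE'
  set M : ℝ := (1 + t) * E + (1 + t⁻¹) * E' + a' * (β + ρ' * Bs) ^ 2 with hM
  set sN : ℝ := Real.sqrt (c₁ / (c₀ * ((L : ℝ) ^ (n + 1)) ^ d)) with hsN
  have hcN0 : 0 < cN := by rw [hcN, hNr]; positivity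
  have hβS : ((((L ^ (n + 1) : ℕ) : ℝ)) ^ d)⁻¹ * (∑ k ∈ Finset.range (L ^ (n + 1)), (cN + (k : ℝ) * (((L ^ (n + 1) : ℕ) : ℝ) - 1 - k))) ^ d = β := by
    rw [sum_pedestal_eq, hcN, hNr, hβ, ← inv_pow, ← mul_pow]
    congr 1
    field_simp
    ring
  have hβ0 : 0 < β := by rw [hβ]; positivity
  have hBs0 : 0 ≤ Bs := by rw [hBs]; positivity
  have hρw0 : 0 < ρw := by rw [hρw]; positivity
  have hεR0 : 0 ≤ εR := by rw [hεR]; positivity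
  have hK0 : 0 ≤ 2 * Mφ * Mφ' := by positivity
  have hρ'0 : 0 ≤ ρ' := by rw [hρ']; exact rhoTower_nonneg n hK0 εU hεU (d * (L - 1))
  have hΦ0 : 0 ≤ Φ := by rw [hΦ]; positivity
  have hE0 : 0 ≤ E := by rw [hE]; positivity
  have hE'0 : 0 ≤ E' := by rw [hE']; positivity
  have hM0 : 0 < M := by rw [hM]; positivity
  have hsN0 : 0 < sN := by rw [hsN]; positivity
  have hwin' : ρ' * Bs ≤ θ * β := hwin
  have ht1 : 0 < 1 + t⁻¹ := by positivity
  have hsq1 : sN * Real.sqrt ρw = 1 := by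
    rw [hsN, hρw, ← Real.sqrt_mul (by positivity),
      show c₁ / (c₀ * ((L : ℝ) ^ (n + 1)) ^ d) * (c₀ * ((L : ℝ) ^ (n + 1)) ^ d / c₁) = 1 by field_simp, Real.sqrt_one]
  -- the test vector: the pedestal lift at block size `L^{n+1}`, carried to the tower typing by the site isometry
  set ψt := WL2.equiv ℂ (fun _ : TSite d m => c₁) W ψ with hψt
  set uN : SiteL2K ℂ d (fineP (L ^ (n + 1)) m) c₀ W := (WL2.equiv ℂ (fun _ : TSite d (fineP (L ^ (n + 1)) m) => c₀) W).symm
    (fun x => (((∏ ν, (cN + ((offset (L ^ (n + 1)) m x ν : ℕ) : ℝ) * (((L ^ (n + 1) : ℕ) : ℝ) - 1 - (offset (L ^ (n + 1)) m x ν : ℕ)))) : ℝ) : ℂ) •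
      ψt (blockCoord (L ^ (n + 1)) m x)) with huN
  set u : SiteL2K ℂ d (towerP L m (n + 1)) c₀ W := (siteL2Cast ℂ h).symm uN with hu
  have hcast : siteL2Cast ℂ h u = uN := LinearEquiv.apply_symm_apply _ _
  have hQ₁u : Q₁ u = ((β : ℝ) : ℂ) • ψ := by
    have e1 : Q₁ u = ((WL2.linearEquiv ℂ ℂ (fun _ : TSite d m => c₁)).symm.toLinearMap ∘ₗ
        QprimeW (L ^ (n + 1)) m φ (fun _ : Bond d (fineP (L ^ (n + 1)) m) => (1 : 𝔸ˣ)) (c₀ := c₀)) uN := by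
      rw [hQ₁, Qtildek_one_eq_oneStep L m n φ h, LinearMap.comp_apply, LinearEquiv.coe_toLinearMap, hcast]
    rw [e1, ← hβS, huN]
    exact QprimeWL2_one_lift (L ^ (n + 1)) m φ c₀ c₁ _ (fun y => sum_blockOf_pedestal (L ^ (n + 1)) m cN y) ψ
  have hnu : ‖u‖ = ‖uN‖ := by rw [← norm_siteL2Cast ℂ h u, hcast]
  have hun : ‖u‖ ^ 2 ≤ Bs ^ 2 * ρw * ‖ψ‖ ^ 2 := by
    have h1 := norm_sq_lift_le (L ^ (n + 1)) m c₀ c₁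
      (fun x => ∏ ν, (cN + ((offset (L ^ (n + 1)) m x ν : ℕ) : ℝ) * (((L ^ (n + 1) : ℕ) : ℝ) - 1 - (offset (L ^ (n + 1)) m x ν : ℕ))))
      (abs_pedestal_le (L ^ (n + 1)) m hcN0.le) ψ
    rw [hnu, hBs, hρw, ← hNr]
    rw [hcN] at h1
    exact h1
  have hun' : ‖u‖ ≤ Bs * Real.sqrt ρw * ‖ψ‖ := by
    have h2 : (Bs * Real.sqrt ρw * ‖ψ‖) ^ 2 = Bs ^ 2 * ρw * ‖ψ‖ ^ 2 := by rw [mul_pow, mul_pow, Real.sq_sqrt hρw0.le]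
    exact (pow_le_pow_iff_left₀ (norm_nonneg _) (by positivity) two_ne_zero).1 (h2 ▸ hun)
  -- the transporter letter (finest level) and the tower averaging letters
  have hR : ∀ (b : Bond d (towerP L m (n + 1))) (w : W), ‖adTransportW φ U b w - w‖ ≤ εR * ‖w‖ := fun b w => by
    rw [hεR]; exact norm_adTransportW_sub_le φ hφ hφ' hMφ' U b (hU b) (hUε b) w
  have hR₁ : ∀ (b : Bond d (towerP L m (n + 1))) (w : W), adTransportW φ (fun _ : Bond d (towerP L m (n + 1)) => (1 : 𝔸ˣ)) b w = w :=
    fun b w => by rw [adTransportW_one]; rfl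
  have hQl : ∀ v, ‖Q v - Q₁ v‖ ≤ ρ' * sN * ‖v‖ := fun v =>
    norm_QtildeTower_sub_flat_le L m n φ hMφ hMφ' hφ hφ' (c₀ := c₀) c₁ U εU hεU hLε hLb v
  have hQ1l : ∀ v, ‖Q₁ v‖ ≤ sN * ‖v‖ := fun v => norm_QtildeTower_one_le L m n φ (c₀ := c₀) c₁ (𝔸 := 𝔸) v
  have hδ : ‖Q u - Q₁ u‖ ≤ ρ' * Bs * ‖ψ‖ :=
    calc ‖Q u - Q₁ u‖ ≤ ρ' * sN * ‖u‖ := hQl u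
      _ ≤ ρ' * sN * (Bs * Real.sqrt ρw * ‖ψ‖) := mul_le_mul_of_nonneg_left hun' (by positivity)
      _ = ρ' * Bs * (sN * Real.sqrt ρw) * ‖ψ‖ := by ring
      _ = ρ' * Bs * ‖ψ‖ := by rw [hsq1, mul_one]
  have hQu : Q u = ((β : ℝ) : ℂ) • ψ + (Q u - Q₁ u) := by rw [hQ₁u]; abel
  -- (1) `(1−θ)β‖ψ‖² ≤ re⟪u, Q†ψ⟫`
  have hux : (1 - θ) * β * ‖ψ‖ ^ 2 ≤ RCLike.re ⟪u, LinearMap.adjoint Q ψ⟫_ℂ := by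
    rw [LinearMap.adjoint_inner_right, hQu, inner_add_left, map_add, inner_smul_left, Complex.conj_ofReal]
    have e1 : RCLike.re ((β : ℂ) * ⟪ψ, ψ⟫_ℂ) = β * ‖ψ‖ ^ 2 := by
      rw [← inner_self_eq_norm_sq (𝕜 := ℂ) ψ]; simp only [RCLike.re_to_complex, Complex.re_ofReal_mul]
    rw [e1]
    have e2 : |RCLike.re ⟪Q u - Q₁ u, ψ⟫_ℂ| ≤ ρ' * Bs * ‖ψ‖ * ‖ψ‖ :=
      (RCLike.abs_re_le_norm _).trans ((norm_inner_le_norm _ _).trans (mul_le_mul_of_nonneg_right hδ (norm_nonneg _)))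
    have e3 := neg_le_of_abs_le e2
    have h5 : ρ' * Bs * ‖ψ‖ * ‖ψ‖ ≤ θ * β * ‖ψ‖ ^ 2 := by
      rw [mul_assoc (ρ' * Bs), ← pow_two]; exact mul_le_mul_of_nonneg_right hwin' (sq_nonneg _)
    linarith [e3, h5]
  -- (2) `re⟪u, Tu⟫ ≤ M‖ψ‖²`
  have huu : RCLike.re ⟪u, T u⟫_ℂ ≤ M * ‖ψ‖ ^ 2 := by
    rw [hT, re_inner_laplacePrimeAk L m n φ η U a' hRS u]
    -- the flat Dirichlet form of the pedestal lift at block size `L^{n+1}`: EXACT block sums (leaf-01's split step bound)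
    have hD1 := norm_sq_covDerivL2K_lift_le_split (L ^ (n + 1)) m φ c₀ η c₁
      (fun x => ∏ ν, (cN + ((offset (L ^ (n + 1)) m x ν : ℕ) : ℝ) * (((L ^ (n + 1) : ℕ) : ℝ) - 1 - (offset (L ^ (n + 1)) m x ν : ℕ)))) ψ
      (fun μ x => (if offset (L ^ (n + 1)) m x μ + 1 < L ^ (n + 1) then
          ((((L ^ (n + 1) : ℕ) : ℝ)) - 2 - 2 * (offset (L ^ (n + 1)) m x μ : ℕ)) ^ 2 else 2 * cN ^ 2) *
        (∏ ν ∈ Finset.univ.erase μ, (cN + ((offset (L ^ (n + 1)) m x ν : ℕ) : ℝ) *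
          (((L ^ (n + 1) : ℕ) : ℝ) - 1 - (offset (L ^ (n + 1)) m x ν : ℕ)))) ^ 2)
      (fun μ x => (if offset (L ^ (n + 1)) m x μ = 0 then 2 * cN ^ 2 else 0) *
        (∏ ν ∈ Finset.univ.erase μ, (cN + ((offset (L ^ (n + 1)) m x ν : ℕ) : ℝ) *
          (((L ^ (n + 1) : ℕ) : ℝ) - 1 - (offset (L ^ (n + 1)) m x ν : ℕ)))) ^ 2)
      (Φ := Φ) (fun x μ => pedestal_step_le (L ^ (n + 1)) m cN ψt x μ)
      (fun y => by
        rw [sum_blockOf_pedestal_weights (L ^ (n + 1)) m cN y, sum_pedestal_sq_eq, hΦ, hcN, hNr]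
        exact le_of_eq (by ring))
    have hD1' : ‖covDerivL2K ℂ c₀ ((η : ℂ))⁻¹ (adTransportW φ (fun _ : Bond d (towerP L m (n + 1)) => (1 : 𝔸ˣ))) u‖ ^ 2 ≤ E * ‖ψ‖ ^ 2 := by
      have e1 : ‖covDerivL2K ℂ c₀ ((η : ℂ))⁻¹ (adTransportW φ (fun _ : Bond d (towerP L m (n + 1)) => (1 : 𝔸ˣ))) u‖ =
          ‖covDerivL2K ℂ c₀ ((η : ℂ))⁻¹ (adTransportW φ (fun _ : Bond d (fineP (L ^ (n + 1)) m) => (1 : 𝔸ˣ))) uN‖ := by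
        rw [hu, siteL2Cast_symm_apply', norm_covDerivL2K_one_siteL2Cast']
      rw [e1, hE]
      exact hD1
    -- `‖D_U u‖ ≤ ‖D_1 u‖ + |η⁻¹|εR√d‖u‖`
    have hdiff := norm_covDerivL2K_sub_le (𝕜 := ℂ) (c₀ := c₀) (c := ((η : ℂ))⁻¹) (R := adTransportW φ U)
      (R₁ := adTransportW φ (fun _ : Bond d (towerP L m (n + 1)) => (1 : 𝔸ˣ))) hεR0 hR hR₁ u
    have hDU : ‖covDerivL2K ℂ c₀ ((η : ℂ))⁻¹ (adTransportW φ U) u‖ ≤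
        ‖covDerivL2K ℂ c₀ ((η : ℂ))⁻¹ (adTransportW φ (fun _ : Bond d (towerP L m (n + 1)) => (1 : 𝔸ˣ))) u‖ +
          ‖((η : ℂ))⁻¹‖ * εR * Real.sqrt d * ‖u‖ :=
      (norm_le_insert' _ _).trans (add_le_add le_rfl hdiff)
    have ha₁ : ‖covDerivL2K ℂ c₀ ((η : ℂ))⁻¹ (adTransportW φ (fun _ : Bond d (towerP L m (n + 1)) => (1 : 𝔸ˣ))) u‖ ≤ Real.sqrt E * ‖ψ‖ := by
      have h2 : (Real.sqrt E * ‖ψ‖) ^ 2 = E * ‖ψ‖ ^ 2 := by rw [mul_pow, Real.sq_sqrt hE0]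
      exact (pow_le_pow_iff_left₀ (norm_nonneg _) (by positivity) two_ne_zero).1 (h2 ▸ hD1')
    have ha₂ : ‖((η : ℂ))⁻¹‖ * εR * Real.sqrt d * ‖u‖ ≤ ‖((η : ℂ))⁻¹‖ * εR * Real.sqrt d * (Bs * Real.sqrt ρw * ‖ψ‖) :=
      mul_le_mul_of_nonneg_left hun' (by positivity)
    have hDU' : ‖covDerivL2K ℂ c₀ ((η : ℂ))⁻¹ (adTransportW φ U) u‖ ≤
        (Real.sqrt E + ‖((η : ℂ))⁻¹‖ * εR * Real.sqrt d * Bs * Real.sqrt ρw) * ‖ψ‖ := by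
      refine hDU.trans ?_
      refine (add_le_add ha₁ ha₂).trans (le_of_eq ?_)
      ring
    have hsq : ‖covDerivL2K ℂ c₀ ((η : ℂ))⁻¹ (adTransportW φ U) u‖ ^ 2 ≤ ((1 + t) * E + (1 + t⁻¹) * E') * ‖ψ‖ ^ 2 := by
      have h1 : ‖covDerivL2K ℂ c₀ ((η : ℂ))⁻¹ (adTransportW φ U) u‖ ^ 2 ≤
          ((Real.sqrt E + ‖((η : ℂ))⁻¹‖ * εR * Real.sqrt d * Bs * Real.sqrt ρw) * ‖ψ‖) ^ 2 :=
        pow_le_pow_left₀ (norm_nonneg _) hDU' 2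
      refine h1.trans ?_
      have hd0 : (0 : ℝ) ≤ d := Nat.cast_nonneg d
      have e1 : ((Real.sqrt E + ‖((η : ℂ))⁻¹‖ * εR * Real.sqrt d * Bs * Real.sqrt ρw) * ‖ψ‖) ^ 2 ≤
          ((1 + t) * (Real.sqrt E) ^ 2 + (1 + t⁻¹) * (‖((η : ℂ))⁻¹‖ * εR * Real.sqrt d * Bs * Real.sqrt ρw) ^ 2) * ‖ψ‖ ^ 2 := by
        rw [mul_pow]
        exact mul_le_mul_of_nonneg_right (add_sq_le_weighted' ht _ _) (sq_nonneg _)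
      refine e1.trans (le_of_eq ?_)
      rw [Real.sq_sqrt hE0, mul_pow, mul_pow, mul_pow, mul_pow, Real.sq_sqrt hd0, Real.sq_sqrt hρw0.le, hE']
    -- averaging part: `‖Q u‖ ≤ (β♯ + ρ_k B♯)‖ψ‖`
    have hQn : ‖Q u‖ ≤ (β + ρ' * Bs) * ‖ψ‖ := by
      rw [hQu]
      refine (norm_add_le _ _).trans ?_
      rw [norm_smul, Complex.norm_real, Real.norm_eq_abs, abs_of_pos hβ0, add_mul]
      exact add_le_add le_rfl hδ
    have hQsq : a' * ‖Q u‖ ^ 2 ≤ a' * ((β + ρ' * Bs) ^ 2 * ‖ψ‖ ^ 2) := by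
      refine mul_le_mul_of_nonneg_left ?_ ha'.le
      rw [← mul_pow]; exact pow_le_pow_left₀ (norm_nonneg _) hQn 2
    rw [← hQ]
    calc _ ≤ ((1 + t) * E + (1 + t⁻¹) * E') * ‖ψ‖ ^ 2 + a' * ((β + ρ' * Bs) ^ 2 * ‖ψ‖ ^ 2) := add_le_add hsq hQsq
      _ = M * ‖ψ‖ ^ 2 := by rw [hM]; ring
  -- (3) the first-order variational principle, (4) Cauchy–Schwarz with `‖Q̃′_k(U)‖ ≤ (1 + ρ_k)·√(c₁∕(c₀N^d))`
  have hG : ∀ z, GpOfUk L m n φ η U a' (c₁ := c₁) hpos' z = greenK T hpos' z := fun z => rfl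
  have hθβ : (0 : ℝ) ≤ (1 - θ) * β := mul_nonneg (by linarith) hβ0.le
  have hκ₁ := sq_div_mul_le_re_inner_green hTs hpos' hM0 hθβ hux huu
  have hN1 : 0 < (1 + ρ') * sN := by positivity
  have hQv : ∀ v, ‖Q v‖ ≤ (1 + ρ') * sN * ‖v‖ := fun v =>
    calc ‖Q v‖ ≤ ‖Q₁ v‖ + ‖Q v - Q₁ v‖ := norm_le_insert' _ _
      _ ≤ sN * ‖v‖ + ρ' * sN * ‖v‖ := add_le_add (hQ1l v) (hQl v)
      _ = (1 + ρ') * sN * ‖v‖ := by ring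
  have hfin := sq_mul_norm_sq_le_re_inner_qggq hTs hpos' Q hN1 (div_nonneg (sq_nonneg _) hM0.le) hQv ψ hκ₁
  -- (5) the constant
  have hconst : (((1 - θ) * β) ^ 2 / M / ((1 + ρ') * sN)) ^ 2 =
      (((1 - θ) * β) ^ 2 / M) ^ 2 * (c₀ * ((L : ℝ) ^ (n + 1)) ^ d / c₁) / (1 + ρ') ^ 2 := by
    rw [hsN, div_pow, mul_pow (1 + ρ'), Real.sq_sqrt (by positivity)]
    field_simp
  rw [hconst, hM, hE, hE', hΦ, hBs, hρw, hρ', hεR] at hfin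
  simpa only [LinearMap.comp_apply, hG] using hfin

end Window

end Literature.MathematicalPhysics.QuantumFieldTheory.Balaban1983to89.B9Eq365QGGQLowerVariationalWindowTowerSharp

end
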